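import Mathlib
import HarnessLib
import Literature.MathematicalPhysics.PowerSystems.SinusoidalCouplingSectorBound

/-!
# The strict (two-sided) sector bound for the sinusoidal coupling on `|δ| ≤ π/2`
# (Vu–Turitsyn, IEEE TAC 2017, §IV-A «Strict Bounds for Nonlinear Couplings»)

Topic `Literature/MathematicalPhysics/PowerSystems`, namespace
`Literature.MathematicalPhysics.PowerSystems.SinusoidalCoupling` (continues
`SinusoidalCouplingSectorBound.lean`, which holds the one-sided bound of Vu–Turitsyn 2016 on the
larger polytope `|δ + δ*| ≤ π`). Everything below is PROVED from Mathlib (no named facts, no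
definitions, no new axioms).

Source (held arXiv text, materialised with `lit read arxiv:1504.04684`, chunk p0009): T. L. Vu,
K. Turitsyn, *A Framework for Robust Assessment of Power Grid Stability and Resiliency*, IEEE
Trans. Automatic Control 62 (3) (2017) 1165–1177 [VuTuritsyn2017], §IV-A. Locators are the
section / display labels of that text; no printed page numbers are asserted.

> «we observe that for all values of δ_kj = δ_k − δ_j such that |δ_kj| ≤ π/2, we have:
> g_kj (δ_kj − δ*_kj)² ≤ (δ_kj − δ*_kj)(sin δ_kj − sin δ*_kj) ≤ (δ_kj − δ*_kj)²   (bound)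
> where g_kj = min{ (1 − sin δ*_kj)/(π/2 − δ*_kj), (1 + sin δ*_kj)/(π/2 + δ*_kj) }
> = (1 − sin|δ*_kj|)/(π/2 − |δ*_kj|).
> As the function (1 − sin t)/(π/2 − t) is decreasing on [0, π/2], it holds that
> g_kj ≥ (1 − sin λ(δ*))/(π/2 − λ(δ*)) := g > 0
> where λ(δ*) is the maximum value of |δ*_kj| over all the lines {k,j} ∈ E, and
> 0 ≤ λ(δ*) ≤ γ < π/2. … hence (F(Cx) − gCx)ᵀ(F(Cx) − Cx) ≤ 0 ∀ x ∈ P.»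

The source justifies (bound) by «From Fig. 2, we observe» — no proof is printed. The proof
below: for `δ* ≥ 0` and `δ ∈ [0, π/2]` the secant slope of `sin` through `δ*` is bounded
below by the secant slope to `π/2` (concavity of `sin` on `[0, π]`, Mathlib
`strictConcaveOn_sin_Icc` + `ConvexOn.secant_mono` applied to `−sin`); for `δ* ≥ 0 > δ`
Jordan's inequality `sin t ≥ (2/π)t` on `[0, π/2]` (Mathlib `Real.mul_le_sin`) gives the
slope `≥ 2/π ≥ g(δ*)`; the case `δ* < 0` follows by the symmetry `(δ, δ*) ↦ (−δ, −δ*)`.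
The monotonicity remark is the secant-slope monotonicity of the convex function `−cos` on
`[0, π/2]` read through `1 − sin t = 1 − cos(π/2 − t)`.

## Rendering

* `g(δ*)` is written out as `(1 − sin|δ*|)/(π/2 − |δ*|)`; the standing hypothesis
  `|δ*_kj| ≤ λ(δ*) < π/2` of the source (its SEP set Δ(γ), γ < π/2) is the explicit hypothesis
  `|δ*| < π/2`; `|δ_kj| ≤ π/2` is the polytope `P` of the source.
* The upper half `(δ − δ*)(sin δ − sin δ*) ≤ (δ − δ*)²` holds for all reals and is already the
  theorem `sector_le_sq` of `SinusoidalCouplingSectorBound.lean`; it is not repeated.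
* Everything is model-free real analysis; in the source it feeds Lemma 1–2 (a local circle
  criterion / LMI) for the structure-preserving model (MODELLED there, not here).
-/

namespace Literature.MathematicalPhysics.PowerSystems.SinusoidalCoupling

open Real Set

/-- Concavity step (private helper): for `0 ≤ a < π/2`, `0 ≤ x ≤ π/2`, `x ≠ a`, the secant
slope of `sin` through `a` and `x` is at least the secant slope through `a` and `π/2`:
`(1 − sin a)/(π/2 − a) ≤ (sin x − sin a)/(x − a)`. [folklore] -/
private theorem secant_sin_ge_endpoint {a x : ℝ} (ha0 : 0 ≤ a) (ha1 : a < π / 2)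
    (hx0 : 0 ≤ x) (hx1 : x ≤ π / 2) (hxa : x ≠ a) :
    (1 - Real.sin a) / (π / 2 - a) ≤ (Real.sin x - Real.sin a) / (x - a) := by
  have hconv : ConvexOn ℝ (Icc 0 π) (-Real.sin) := strictConcaveOn_sin_Icc.concaveOn.neg
  have hpi := Real.pi_pos
  have ha : a ∈ Icc 0 π := ⟨ha0, by linarith⟩
  have hx : x ∈ Icc 0 π := ⟨hx0, by linarith⟩
  have hy : π / 2 ∈ Icc 0 π := ⟨by linarith, by linarith⟩
  have hya : π / 2 ≠ a := ne_of_gt ha1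
  have hmono := hconv.secant_mono ha hx hy hxa hya hx1
  -- hmono : ((-sin) x - (-sin) a)/(x - a) ≤ ((-sin) (π/2) - (-sin) a)/(π/2 - a)
  simp only [Pi.neg_apply, Real.sin_pi_div_two] at hmono
  have h1 : (-Real.sin x - -Real.sin a) / (x - a) = -((Real.sin x - Real.sin a) / (x - a)) := by
    ring
  have h2 : (-1 - -Real.sin a) / (π / 2 - a) = -((1 - Real.sin a) / (π / 2 - a)) := by ring
  rw [h1, h2] at hmono
  linarith

/-- Jordan step (private helper): for `0 ≤ a < π/2`, `(1 − sin a)/(π/2 − a) ≤ 2/π`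
(equivalent to Jordan's inequality `(2/π) a ≤ sin a`). [folklore] -/
private theorem endpoint_slope_le_two_div_pi {a : ℝ} (ha0 : 0 ≤ a) (ha1 : a < π / 2) :
    (1 - Real.sin a) / (π / 2 - a) ≤ 2 / π := by
  have hpi := Real.pi_pos
  have hJ : 2 / π * a ≤ Real.sin a := Real.mul_le_sin ha0 ha1.le
  have hpos : 0 < π / 2 - a := by linarith
  rw [div_le_div_iff₀ hpos hpi]
  -- (1 - sin a) * π ≤ 2 * (π/2 - a)  ⟸  π sin a ≥ 2a
  have : 2 * a ≤ π * Real.sin a := by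
    have := mul_le_mul_of_nonneg_left hJ hpi.le
    calc 2 * a = π * (2 / π * a) := by field_simp
      _ ≤ π * Real.sin a := this
  nlinarith

/-- The lower strict sector bound for a NON-NEGATIVE equilibrium value (private; the public
theorem removes the sign assumption by symmetry). [folklore] -/
private theorem strictSector_lower_of_nonneg {δ δs : ℝ} (hδs0 : 0 ≤ δs) (hδs1 : δs < π / 2)
    (hδ : |δ| ≤ π / 2) :
    (1 - Real.sin δs) / (π / 2 - δs) * (δ - δs) ^ 2 ≤ (δ - δs) * (Real.sin δ - Real.sin δs) := by
  have hpi := Real.pi_pos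
  obtain ⟨hδlo, hδhi⟩ := abs_le.mp hδ
  rcases eq_or_ne δ δs with heq | hne
  · subst heq; simp
  rcases le_or_gt 0 δ with hδ0 | hδ0
  · -- 0 ≤ δ ≤ π/2: concavity
    have hs := secant_sin_ge_endpoint hδs0 hδs1 hδ0 hδhi hne
    have hx2 : 0 < (δ - δs) ^ 2 := by positivity
    have key : (Real.sin δ - Real.sin δs) / (δ - δs) * (δ - δs) ^ 2
        = (δ - δs) * (Real.sin δ - Real.sin δs) := by
      have hne' : δ - δs ≠ 0 := sub_ne_zero.mpr hne
      field_simp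
    calc (1 - Real.sin δs) / (π / 2 - δs) * (δ - δs) ^ 2
        ≤ (Real.sin δ - Real.sin δs) / (δ - δs) * (δ - δs) ^ 2 :=
          mul_le_mul_of_nonneg_right hs hx2.le
      _ = (δ - δs) * (Real.sin δ - Real.sin δs) := key
  · -- −π/2 ≤ δ < 0 ≤ δ*: Jordan's inequality on both sides of 0
    have hg := endpoint_slope_le_two_div_pi hδs0 hδs1
    have hJ1 : 2 / π * δs ≤ Real.sin δs := Real.mul_le_sin hδs0 hδs1.le
    have hJ2 : 2 / π * (-δ) ≤ Real.sin (-δ) := Real.mul_le_sin (by linarith) (by linarith)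
    rw [Real.sin_neg] at hJ2
    -- sin δ* − sin δ ≥ (2/π)(δ* − δ) > 0 and δ* − δ > 0
    have hdiff : 2 / π * (δs - δ) ≤ Real.sin δs - Real.sin δ := by linarith
    have hpos : 0 < δs - δ := by linarith
    have hprod : 2 / π * (δ - δs) ^ 2 ≤ (δ - δs) * (Real.sin δ - Real.sin δs) := by
      have : (δ - δs) * (Real.sin δ - Real.sin δs) = (δs - δ) * (Real.sin δs - Real.sin δ) := by
        ring
      rw [this, show (δ - δs) ^ 2 = (δs - δ) * (δs - δ) by ring]
      calc 2 / π * ((δs - δ) * (δs - δ)) = (δs - δ) * (2 / π * (δs - δ)) := by ring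
        _ ≤ (δs - δ) * (Real.sin δs - Real.sin δ) := mul_le_mul_of_nonneg_left hdiff hpos.le
    have hx2 : 0 ≤ (δ - δs) ^ 2 := sq_nonneg _
    calc (1 - Real.sin δs) / (π / 2 - δs) * (δ - δs) ^ 2
        ≤ 2 / π * (δ - δs) ^ 2 := mul_le_mul_of_nonneg_right hg hx2
      _ ≤ (δ - δs) * (Real.sin δ - Real.sin δs) := hprod

/-- **Strict lower sector bound** (Vu–Turitsyn 2017, §IV-A, display (bound), lower half): for an
equilibrium difference with `|δ*| < π/2` and any `|δ| ≤ π/2`,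
`g(δ*)·(δ − δ*)² ≤ (δ − δ*)(sin δ − sin δ*)` with `g(δ*) = (1 − sin|δ*|)/(π/2 − |δ*|)`.
(The upper half `≤ (δ − δ*)²` is `sector_le_sq`.)
[cite: VuTuritsyn2017, §IV-A display (bound) and the formula for g_kj] -/
theorem strictSector_lower {δ δs : ℝ} (hδs : |δs| < π / 2) (hδ : |δ| ≤ π / 2) :
    (1 - Real.sin |δs|) / (π / 2 - |δs|) * (δ - δs) ^ 2
      ≤ (δ - δs) * (Real.sin δ - Real.sin δs) := by
  rcases le_or_gt 0 δs with h0 | h0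
  · rw [abs_of_nonneg h0] at hδs ⊢
    exact strictSector_lower_of_nonneg h0 hδs hδ
  · -- δ* < 0: apply the non-negative case to (−δ, −δ*)
    have h0' : 0 ≤ -δs := by linarith
    rw [abs_of_neg h0] at hδs ⊢
    have hδ' : |(-δ)| ≤ π / 2 := by rwa [abs_neg]
    have h := strictSector_lower_of_nonneg (δ := -δ) h0' hδs hδ'
    simp only [Real.sin_neg] at h
    have e1 : (-δ - -δs) ^ 2 = (δ - δs) ^ 2 := by ring
    have e2 : (-δ - -δs) * (-Real.sin δ - -Real.sin δs) = (δ - δs) * (Real.sin δ - Real.sin δs) := by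
      ring
    rw [e1, e2] at h
    rw [Real.sin_neg]
    exact h

/-- **The printed formula for `g_kj`** (Vu–Turitsyn 2017, §IV-A): for `|δ*| < π/2`,
`min{(1 − sin δ*)/(π/2 − δ*), (1 + sin δ*)/(π/2 + δ*)} = (1 − sin|δ*|)/(π/2 − |δ*|)`.
[cite: VuTuritsyn2017, §IV-A formula for g_kj] -/
theorem sectorGain_eq_min {δs : ℝ} (hδs : |δs| < π / 2) :
    min ((1 - Real.sin δs) / (π / 2 - δs)) ((1 + Real.sin δs) / (π / 2 + δs))
      = (1 - Real.sin |δs|) / (π / 2 - |δs|) := by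
  have hpi := Real.pi_pos
  obtain ⟨hlo, hhi⟩ := abs_lt.mp hδs
  -- the two candidates are g(δ*) and g(−δ*) with g t = (1 − sin t)/(π/2 − t); g is antitone on
  -- ]−π/2, π/2[ in the sense needed: for 0 ≤ t, g t ≤ g (−t).
  have key : ∀ t : ℝ, 0 ≤ t → t < π / 2 →
      (1 - Real.sin t) / (π / 2 - t) ≤ (1 + Real.sin t) / (π / 2 + t) := by
    intro t ht0 ht1
    have hp1 : 0 < π / 2 - t := by linarith
    have hp2 : 0 < π / 2 + t := by linarith
    rw [div_le_div_iff₀ hp1 hp2]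
    -- (1 − sin t)(π/2 + t) ≤ (1 + sin t)(π/2 − t)  ⟺  2t ≤ π sin t  (Jordan)
    have hJ : 2 / π * t ≤ Real.sin t := Real.mul_le_sin ht0 ht1.le
    have : 2 * t ≤ π * Real.sin t := by
      calc 2 * t = π * (2 / π * t) := by field_simp
        _ ≤ π * Real.sin t := mul_le_mul_of_nonneg_left hJ hpi.le
    nlinarith
  rcases le_or_gt 0 δs with h0 | h0
  · rw [abs_of_nonneg h0]
    exact min_eq_left (key δs h0 hhi)
  · rw [abs_of_neg h0, Real.sin_neg]
    have h := key (-δs) (by linarith) (by linarith)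
    rw [Real.sin_neg] at h
    have e1 : (1 : ℝ) - -Real.sin δs = 1 + Real.sin δs := by ring
    have e2 : π / 2 - -δs = π / 2 + δs := by ring
    have e3 : (1 : ℝ) + -Real.sin δs = 1 - Real.sin δs := by ring
    have e4 : π / 2 + -δs = π / 2 - δs := by ring
    rw [e1, e2, e3, e4] at h
    rw [e1, e2]
    exact min_eq_right h

/-- **Monotonicity remark of the source**: «the function (1 − sin t)/(π/2 − t) is decreasing on
[0, π/2]» — for `0 ≤ t₁ ≤ t₂ < π/2`, `g(t₂) ≤ g(t₁)`; hence `g_kj ≥ g := g(λ(δ*))` whenever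
`|δ*_kj| ≤ λ(δ*) < π/2`. [cite: VuTuritsyn2017, §IV-A (g_kj ≥ g, monotonicity sentence)] -/
theorem sectorGain_antitone {t₁ t₂ : ℝ} (h0 : 0 ≤ t₁) (h12 : t₁ ≤ t₂) (h2 : t₂ < π / 2) :
    (1 - Real.sin t₂) / (π / 2 - t₂) ≤ (1 - Real.sin t₁) / (π / 2 - t₁) := by
  have hpi := Real.pi_pos
  -- g t = ((−cos)(u) − (−cos)(0))/(u − 0) with u = π/2 − t: a secant slope of the convex −cos
  have hconv : ConvexOn ℝ (Icc (-(π / 2)) (π / 2)) (-Real.cos) :=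
    strictConcaveOn_cos_Icc.concaveOn.neg
  set u₁ := π / 2 - t₁ with hu₁
  set u₂ := π / 2 - t₂ with hu₂
  have ha : (0 : ℝ) ∈ Icc (-(π / 2)) (π / 2) := ⟨by linarith, by linarith⟩
  have hx : u₂ ∈ Icc (-(π / 2)) (π / 2) := ⟨by linarith, by linarith⟩
  have hy : u₁ ∈ Icc (-(π / 2)) (π / 2) := ⟨by linarith, by linarith⟩
  have hxa : u₂ ≠ 0 := by rw [hu₂]; linarith
  have hya : u₁ ≠ 0 := by rw [hu₁]; linarith
  have hxy : u₂ ≤ u₁ := by linarith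
  have hmono := hconv.secant_mono ha hx hy hxa hya hxy
  simp only [Pi.neg_apply, Real.cos_zero, sub_zero] at hmono
  have c1 : Real.cos u₁ = Real.sin t₁ := by rw [hu₁]; exact Real.cos_pi_div_two_sub t₁
  have c2 : Real.cos u₂ = Real.sin t₂ := by rw [hu₂]; exact Real.cos_pi_div_two_sub t₂
  rw [c1, c2] at hmono
  have e1 : (-Real.sin t₂ - -1) / u₂ = (1 - Real.sin t₂) / (π / 2 - t₂) := by
    rw [hu₂]; congr 1; ring
  have e2 : (-Real.sin t₁ - -1) / u₁ = (1 - Real.sin t₁) / (π / 2 - t₁) := by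
    rw [hu₁]; congr 1; ring
  rw [e1, e2] at hmono
  exact hmono

/-- **Positivity of the sector gain** (Vu–Turitsyn 2017, §IV-A, «g > 0»): for `0 ≤ t < π/2`,
`(1 − sin t)/(π/2 − t) > 0`. [cite: VuTuritsyn2017, §IV-A (g > 0)] -/
theorem sectorGain_pos {t : ℝ} (h0 : 0 ≤ t) (h1 : t < π / 2) :
    0 < (1 - Real.sin t) / (π / 2 - t) := by
  have hpi := Real.pi_pos
  have hs : Real.sin t < 1 := by
    rw [← Real.sin_pi_div_two]
    exact Real.sin_lt_sin_of_lt_of_le_pi_div_two (by linarith) le_rfl h1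
  apply div_pos <;> linarith

/-- **The strict sector condition in Lur'e form** (Vu–Turitsyn 2017, §IV-A, last display): with
`S = sin δ − sin δ*`, `x = δ − δ*`, and any `g' ≤ g(δ*)` (e.g. the uniform
`g = (1 − sin λ)/(π/2 − λ)` of the source), `(S − g'·x)(S − x) ≤ 0` on `|δ| ≤ π/2`.
[cite: VuTuritsyn2017, §IV-A display «(F(Cx) − gCx)ᵀ(F(Cx) − Cx) ≤ 0, ∀ x ∈ P» (scalar case)] -/
theorem lurieSector_nonpos {δ δs g' : ℝ} (hδs : |δs| < π / 2) (hδ : |δ| ≤ π / 2)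
    (hg' : g' ≤ (1 - Real.sin |δs|) / (π / 2 - |δs|)) :
    ((Real.sin δ - Real.sin δs) - g' * (δ - δs)) * ((Real.sin δ - Real.sin δs) - (δ - δs)) ≤ 0 := by
  have hlow := strictSector_lower hδs hδ
  have hup := sector_le_sq δ δs
  have hlip : |Real.sin δ - Real.sin δs| ≤ |δ - δs| := Real.abs_sin_sub_sin_le δ δs
  set S := Real.sin δ - Real.sin δs with hS
  set x := δ - δs with hx
  -- S/x ∈ [g, 1] ⊆ [g', 1] when x ≠ 0, whence (S − g'x)(S − x) = x²(S/x − g')(S/x − 1) ≤ 0.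
  have hg'x : g' * x ^ 2 ≤ x * S :=
    le_trans (mul_le_mul_of_nonneg_right hg' (sq_nonneg x)) hlow
  have hprod : 0 ≤ (x * S - g' * x ^ 2) * (x ^ 2 - x * S) :=
    mul_nonneg (sub_nonneg.mpr hg'x) (sub_nonneg.mpr hup)
  have hid : x ^ 2 * ((S - g' * x) * (S - x)) = -((x * S - g' * x ^ 2) * (x ^ 2 - x * S)) := by
    ring
  rcases eq_or_ne x 0 with hx0 | hx0
  · have hS0 : S = 0 := by
      have : |S| ≤ 0 := by simpa [hx0] using hlip
      exact abs_nonpos_iff.mp this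
    simp [hS0, hx0]
  · have hx2 : 0 < x ^ 2 := by positivity
    by_contra hcon
    push Not at hcon
    have := mul_pos hx2 hcon
    linarith

end Literature.MathematicalPhysics.PowerSystems.SinusoidalCoupling
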